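import Literature.NumberTheory.PAdicHodge.AinfRamifiedWittTopology
import Literature.NumberTheory.PAdicHodge.AinfRamifiedFontaineLimit
import HarnessLib

/-!
# Fontaine's limit `[u] = lim φⁿ(ûₙ)` in `A_inf(𝒪_F) = 𝔸_inf(F)[X]/(E)` over `W(k_F)` for a contracting endomorphism `φ`
# of `𝔫_𝒪 = θ_𝒪⁻¹(𝔪_{ℂ_F})`, and its additivity

Topic `Literature/NumberTheory/PAdicHodge`; the residue-degree-`f` version (Eisenstein datum `D : EisensteinRootW F p hp` over
`W(k_F)`, topological ring `AinfRamWTop D` of `AinfRamifiedWittTopology`) of `AinfRamifiedFontaineLimit` (+ the lemma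
`theta_flim_eq_of_forall` of `AinfRamifiedEtaPeriod`) — VERBATIM transcription: the ideal of definition is `𝔦 = (p, ω)`,
`ω = ϖ − [π♭]`, with the same three properties (`ker θ_𝒪 ⊆ 𝔦`, `θ_𝒪(𝔦ⁿ) ⊆ pⁿ𝒪_{ℂ_F}`, completeness).

Let `φ : 𝔫_𝒪 → 𝔫_𝒪` be **contracting** for the `𝔦`-adic filtration (`IsContracting φ`:
`a ≡ b (mod 𝔦^{n+1}) ⇒ φ(a) ≡ φ(b) (mod 𝔦^{n+2})`; e.g. an iterate of `[π]_f` for a Lubin–Tate law over `𝒪_D`), and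
`u : ℕ → 𝔫_𝒪` with `φ(u_{n+1}) ≡ u_n (mod 𝔦)`. Then:
* §1 convergence tools (`tendsto_of_forall_sub_mem_pow`, `exists_lim_of_forall_sub_mem_pow_succ`, `eq_of_forall_sub_mem_pow`);
* §2 `approx φ u n = φⁿ(uₙ)` is Cauchy, **`flim φ u`** its limit (`flim_sub_approx_mem`, `eq_flim_of_forall_sub_mem`,
  `tendsto_approx_flim`), independence of lifts (`flim_congr`), `θ_𝒪(flim) = 0` when `θ_𝒪(φⁿuₙ) = 0` (`theta_flim_eq_zero`),
  equivariance under continuous maps commuting with `φ` (`map_flim`, e.g. `σ ∈ Γ_F`);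
* §3 `flim ∈ 𝔫_𝒪` (`flimPt`) and **additivity `[u ⊕ u'] = [u] ⊕ [u']`** for a congruence-continuous `⊕` commuting with `φ`
  (`flim_op`);
* §4 `θ_𝒪(flim) = c` when every approximant has `θ_𝒪`-value `c` (`theta_flim_eq_of_forall`).

Definitions (reviewed): `AinfRamWTop.IsContracting`, `.approx`, `.flim`, `.flimPt`. No named facts, no instances, no `sorry`.

## References
* J.-M. Fontaine, *Le corps des périodes p-adiques*, Astérisque 223 (1994), Exp. II §1.2.1–1.2.2. [FontaineAsterisque223III]
* J.-M. Fontaine, Y. Ouyang, *Theory of p-adic Galois representations*, §4.4. [FontaineOuyang2022]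
* L. Fargues, J.-M. Fontaine, Astérisque 406 (2018), §1.2, §2.2. [FarguesFontaine2018]
-/

noncomputable section

open Ideal Filter Topology Field WittVector ValuativeRel

namespace Literature.NumberTheory.PAdicHodge

open Literature.NumberTheory.GaloisRepresentations
open Literature.NumberTheory.GaloisRepresentations.IsNonarchimedeanLocalField
open Literature.NumberTheory.GaloisRepresentations.LubinTate

namespace AinfRamWTop

variable {F : Type} [Field F] [ValuativeRel F] [TopologicalSpace F] [IsNonarchimedeanLocalField F] [CharZero F]
  {p : ℕ} [Fact p.Prime] [Fact (¬ IsUnit (p : integerC F))]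
  [IsAdicComplete (Ideal.span {(p : integerC F)}) (integerC F)] {hp : valuation F p < 1} {D : EisensteinRootW F p hp}
  {hθ : Function.Surjective (fontaineTheta (integerC F) p)}

/-! ## §1 Convergence tools in `AinfRamWTop` -/

omit [IsAdicComplete (Ideal.span {(p : integerC F)}) (integerC F)] in
/-- A sequence with `L − f n ∈ (p,ω)^{n+1}` tends to `L`. [cite: FontaineAsterisque223III, Exp. II §1.3.1] -/
theorem tendsto_of_forall_sub_mem_pow {f : ℕ → AinfRamWTop D} {L : AinfRamWTop D}
    (h : ∀ n, L - f n ∈ (WithIdeal.i ^ (n + 1) : Ideal (AinfRamWTop D))) : Tendsto f atTop (𝓝 L) := by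
  rw [(Ideal.hasBasis_nhds_adic (WithIdeal.i : Ideal (AinfRamWTop D)) L).tendsto_right_iff]
  intro m _
  rw [Filter.eventually_atTop]
  refine ⟨m, fun n hn => ⟨f n - L, ?_, by abel⟩⟩
  have h1 : f n - L = -(L - f n) := by abel
  rw [SetLike.mem_coe, h1]
  exact Submodule.neg_mem _ (Ideal.pow_le_pow_right (by omega) (h n))

/-- **Completeness in membership form**: a sequence with `f(n+1) − f(n) ∈ (p,ω)^{n+1}` has a limit `L` with
`L − f(n) ∈ (p,ω)^{n+1}`. [cite: FontaineAsterisque223III, Exp. II §1.3.2] -/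
theorem exists_lim_of_forall_sub_mem_pow_succ {f : ℕ → AinfRamWTop D}
    (hf : ∀ n, f (n + 1) - f n ∈ (WithIdeal.i ^ (n + 1) : Ideal (AinfRamWTop D))) :
    ∃ L : AinfRamWTop D, ∀ n, L - f n ∈ (WithIdeal.i ^ (n + 1) : Ideal (AinfRamWTop D)) := by
  haveI : IsAdicComplete (WithIdeal.i : Ideal (AinfRamWTop D)) (AinfRamWTop D) :=
    isAdicComplete_ideal D
  -- shift the sequence by one so that the tree's membership-form completeness applies with exponent `n + 1`
  obtain ⟨L, hL⟩ := Literature.RingTheory.AdicTopology.AdicPair.exists_lim_of_forall_sub_mem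
    (I := (WithIdeal.i : Ideal (AinfRamWTop D))) (fun n => f (n - 1)) fun n => by
      rcases n with _ | n
      · simp
      · simpa using hf n
  exact ⟨L, fun n => by simpa using hL (n + 1)⟩

/-- Uniqueness of such limits (`A_inf(𝒪)` is `(p,ω)`-adically separated). [cite: FontaineAsterisque223III, Exp. II §1.3.2] -/
theorem eq_of_forall_sub_mem_pow {L L' : AinfRamWTop D}
    (h : ∀ n, L - L' ∈ (WithIdeal.i ^ (n + 1) : Ideal (AinfRamWTop D))) : L = L' := by
  haveI : IsAdicComplete (WithIdeal.i : Ideal (AinfRamWTop D)) (AinfRamWTop D) :=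
    isAdicComplete_ideal D
  refine sub_eq_zero.1 (IsHausdorff.haus (IsAdicComplete.toIsHausdorff (I := (WithIdeal.i : Ideal (AinfRamWTop D))))
    _ fun n => ?_)
  rw [smul_eq_mul, Ideal.mul_top, SModEq.zero]
  exact Ideal.pow_le_pow_right (Nat.le_succ n) (h n)

/-! ## §2 Contracting self-maps of `𝔫` and Fontaine's limit -/

variable (hθ) in
/-- **A contracting self-map of `𝔫`**: `a ≡ b (mod (p,ω)^{n+1}) ⇒ φ a ≡ φ b (mod (p,ω)^{n+2})` for all `n`.
For `φ = [p]_𝔉` on the points of a formal group this is Silverman's `[p](X) = p f(X) + g(X^p)` (AEC IV.4.4);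
for `φ = (·)^p` it is the binomial congruence behind `[x] = lim x̂ₙ^{pⁿ}`.
[cite: FontaineAsterisque223III, Exp. II §1.2.1] [cite: SilvermanAEC2009, IV.4.4] -/
def IsContracting (φ : (nilTheta D hθ).toIdeal → (nilTheta D hθ).toIdeal) : Prop :=
  ∀ (n : ℕ) (a b : (nilTheta D hθ).toIdeal),
    (a : AinfRamWTop D) - b ∈ (WithIdeal.i ^ (n + 1) : Ideal (AinfRamWTop D)) →
      (φ a : AinfRamWTop D) - φ b ∈ (WithIdeal.i ^ (n + 2) : Ideal (AinfRamWTop D))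

variable {φ : (nilTheta D hθ).toIdeal → (nilTheta D hθ).toIdeal}

/-- Iterating a contracting map improves a congruence by one step per iteration:
`a ≡ b (mod (p,ω)^{k+1}) ⇒ φⁿ a ≡ φⁿ b (mod (p,ω)^{n+k+1})`. [cite: FontaineAsterisque223III, Exp. II §1.2.1] -/
theorem iterate_sub_iterate_mem (hφ : IsContracting hθ φ) (n : ℕ) :
    ∀ (k : ℕ) (a b : (nilTheta D hθ).toIdeal),
      (a : AinfRamWTop D) - b ∈ (WithIdeal.i ^ (k + 1) : Ideal (AinfRamWTop D)) →
        ((φ^[n] a : (nilTheta D hθ).toIdeal) : AinfRamWTop D) - (φ^[n] b : (nilTheta D hθ).toIdeal) ∈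
          (WithIdeal.i ^ (n + k + 1) : Ideal (AinfRamWTop D)) := by
  induction n with
  | zero => intro k a b h; simpa using h
  | succ n ih =>
    intro k a b h
    rw [Function.iterate_succ_apply', Function.iterate_succ_apply']
    have h1 := hφ (n + k) _ _ (ih k a b h)
    simpa [show n + k + 2 = n + 1 + k + 1 by ring] using h1

variable (φ) in
/-- **The `n`-th approximant `φⁿ(uₙ)`** of Fontaine's limit. [cite: FontaineAsterisque223III, Exp. II §1.2.1] -/
def approx (u : ℕ → (nilTheta D hθ).toIdeal) (n : ℕ) : AinfRamWTop D := ((φ^[n] (u n) : (nilTheta D hθ).toIdeal) : AinfRamWTop D)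

/-- Unfolding `approx`. [cite: FontaineAsterisque223III, Exp. II §1.2.1] -/
theorem approx_def (u : ℕ → (nilTheta D hθ).toIdeal) (n : ℕ) :
    approx φ u n = ((φ^[n] (u n) : (nilTheta D hθ).toIdeal) : AinfRamWTop D) := rfl

/-- **The approximants are Cauchy**: if `φ(u_{n+1}) ≡ u_n (mod (p,ω))` for all `n` then
`φ^{n+1}(u_{n+1}) − φⁿ(u_n) ∈ (p,ω)^{n+1}`. [cite: FontaineAsterisque223III, Exp. II §1.2.1] -/
theorem approx_succ_sub_approx_mem (hφ : IsContracting hθ φ) {u : ℕ → (nilTheta D hθ).toIdeal}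
    (hu : ∀ n, ((φ (u (n + 1)) : (nilTheta D hθ).toIdeal) : AinfRamWTop D) - u n ∈ (WithIdeal.i : Ideal (AinfRamWTop D)))
    (n : ℕ) : approx φ u (n + 1) - approx φ u n ∈ (WithIdeal.i ^ (n + 1) : Ideal (AinfRamWTop D)) := by
  rw [approx_def, approx_def, Function.iterate_succ_apply]
  have h := iterate_sub_iterate_mem hφ n 0 (φ (u (n + 1))) (u n) (by rw [zero_add, pow_one]; exact hu n)
  simpa using h

/-- Existence of the limit. [cite: FontaineAsterisque223III, Exp. II §1.2.1] -/
theorem exists_flim (hφ : IsContracting hθ φ) {u : ℕ → (nilTheta D hθ).toIdeal}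
    (hu : ∀ n, ((φ (u (n + 1)) : (nilTheta D hθ).toIdeal) : AinfRamWTop D) - u n ∈ (WithIdeal.i : Ideal (AinfRamWTop D))) :
    ∃ L : AinfRamWTop D, ∀ n, L - approx φ u n ∈ (WithIdeal.i ^ (n + 1) : Ideal (AinfRamWTop D)) :=
  exists_lim_of_forall_sub_mem_pow_succ (approx_succ_sub_approx_mem hφ hu)

/-- **Fontaine's limit `[u]_φ = lim φⁿ(uₙ)`** for a contracting `φ` and a sequence `u` with
`φ(u_{n+1}) ≡ u_n (mod (p, ω))`. [cite: FontaineAsterisque223III, Exp. II §1.2.1] -/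
def flim (hφ : IsContracting hθ φ) (u : ℕ → (nilTheta D hθ).toIdeal)
    (hu : ∀ n, ((φ (u (n + 1)) : (nilTheta D hθ).toIdeal) : AinfRamWTop D) - u n ∈ (WithIdeal.i : Ideal (AinfRamWTop D))) :
    AinfRamWTop D :=
  Classical.choose (exists_flim hφ hu)

/-- `[u]_φ − φⁿ(uₙ) ∈ (p,ω)^{n+1}`. [cite: FontaineAsterisque223III, Exp. II §1.2.1] -/
theorem flim_sub_approx_mem (hφ : IsContracting hθ φ) {u : ℕ → (nilTheta D hθ).toIdeal}
    (hu : ∀ n, ((φ (u (n + 1)) : (nilTheta D hθ).toIdeal) : AinfRamWTop D) - u n ∈ (WithIdeal.i : Ideal (AinfRamWTop D)))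
    (n : ℕ) : flim hφ u hu - approx φ u n ∈ (WithIdeal.i ^ (n + 1) : Ideal (AinfRamWTop D)) :=
  Classical.choose_spec (exists_flim hφ hu) n

/-- The approximants converge to `[u]_φ`. [cite: FontaineAsterisque223III, Exp. II §1.2.1] -/
theorem tendsto_approx_flim (hφ : IsContracting hθ φ) {u : ℕ → (nilTheta D hθ).toIdeal}
    (hu : ∀ n, ((φ (u (n + 1)) : (nilTheta D hθ).toIdeal) : AinfRamWTop D) - u n ∈ (WithIdeal.i : Ideal (AinfRamWTop D))) :
    Tendsto (approx φ u) atTop (𝓝 (flim hφ u hu)) :=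
  tendsto_of_forall_sub_mem_pow (flim_sub_approx_mem hφ hu)

/-- **Characterisation**: any `L` with `L − φⁿ(uₙ) ∈ (p,ω)^{n+1}` for all `n` is `[u]_φ`.
[cite: FontaineAsterisque223III, Exp. II §1.2.1] -/
theorem eq_flim_of_forall_sub_mem (hφ : IsContracting hθ φ) {u : ℕ → (nilTheta D hθ).toIdeal}
    (hu : ∀ n, ((φ (u (n + 1)) : (nilTheta D hθ).toIdeal) : AinfRamWTop D) - u n ∈ (WithIdeal.i : Ideal (AinfRamWTop D)))
    {L : AinfRamWTop D} (hL : ∀ n, L - approx φ u n ∈ (WithIdeal.i ^ (n + 1) : Ideal (AinfRamWTop D))) :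
    L = flim hφ u hu :=
  eq_of_forall_sub_mem_pow fun n => by
    have : L - flim hφ u hu = (L - approx φ u n) - (flim hφ u hu - approx φ u n) := by ring
    rw [this]
    exact Submodule.sub_mem _ (hL n) (flim_sub_approx_mem hφ hu n)

/-- **Independence of the lifts**: if `uₙ ≡ u'ₙ (mod (p,ω))` for all `n` (e.g. `θ(uₙ) = θ(u'ₙ)`) then
`[u]_φ = [u']_φ`. [cite: FontaineAsterisque223III, Exp. II §1.2.1] -/
theorem flim_congr (hφ : IsContracting hθ φ) {u u' : ℕ → (nilTheta D hθ).toIdeal}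
    (hu : ∀ n, ((φ (u (n + 1)) : (nilTheta D hθ).toIdeal) : AinfRamWTop D) - u n ∈ (WithIdeal.i : Ideal (AinfRamWTop D)))
    (hu' : ∀ n, ((φ (u' (n + 1)) : (nilTheta D hθ).toIdeal) : AinfRamWTop D) - u' n ∈ (WithIdeal.i : Ideal (AinfRamWTop D)))
    (h : ∀ n, ((u n : (nilTheta D hθ).toIdeal) : AinfRamWTop D) - u' n ∈ (WithIdeal.i : Ideal (AinfRamWTop D))) :
    flim hφ u hu = flim hφ u' hu' := by
  refine eq_flim_of_forall_sub_mem hφ hu' fun n => ?_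
  have h1 : approx φ u n - approx φ u' n ∈ (WithIdeal.i ^ (n + 1) : Ideal (AinfRamWTop D)) := by
    rw [approx_def, approx_def]
    have h2 := iterate_sub_iterate_mem hφ n 0 (u n) (u' n) (by rw [zero_add, pow_one]; exact h n)
    simpa using h2
  have : flim hφ u hu - approx φ u' n = (flim hφ u hu - approx φ u n) + (approx φ u n - approx φ u' n) := by ring
  rw [this]
  exact Submodule.add_mem _ (flim_sub_approx_mem hφ hu n) h1

/-- **`θ([u]_φ) = 0`** as soon as `θ(φⁿ(uₙ)) = 0` for all `n` (for `φ = [p]_𝔉` and lifts of a `p`-power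
compatible sequence of torsion points: `[pⁿ]uₙ = u₀ = 0`); by continuity of `θ`.
[cite: FontaineAsterisque223III, Exp. II §1.2.2] -/
theorem theta_flim_eq_zero (hφ : IsContracting hθ φ) {u : ℕ → (nilTheta D hθ).toIdeal}
    (hu : ∀ n, ((φ (u (n + 1)) : (nilTheta D hθ).toIdeal) : AinfRamWTop D) - u n ∈ (WithIdeal.i : Ideal (AinfRamWTop D)))
    (h0 : ∀ n, theta D (approx φ u n) = 0) : theta D (flim hφ u hu) = 0 := by
  have h1 : Tendsto (fun n => theta D (approx φ u n)) atTop (𝓝 (theta D (flim hφ u hu))) :=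
    ((continuous_theta (D := D)).tendsto (flim hφ u hu)).comp (tendsto_approx_flim hφ hu)
  have h2 : (fun n => theta D (approx φ u n)) = fun _ => 0 := funext h0
  rw [h2] at h1
  exact (tendsto_nhds_unique tendsto_const_nhds h1).symm

/-- **Equivariance of Fontaine's limit**: a continuous map `s` of `A_inf(𝒪)` restricting to a self-map `s𝔫` of `𝔫`
that commutes with `φ` (e.g. `σ ∈ Γ_F`, tree `AinfTop.continuous_gal`, `gal_mem_nilTheta`) satisfies
`s([u]_φ) = [s ∘ u]_φ` (`su = s𝔫 ∘ u`). [cite: FontaineAsterisque223III, Exp. II §1.2.2] -/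
theorem map_flim (hφ : IsContracting hθ φ) {s : AinfRamWTop D → AinfRamWTop D} (hs : Continuous s)
    (s𝔫 : (nilTheta D hθ).toIdeal → (nilTheta D hθ).toIdeal)
    (hs𝔫 : ∀ a : (nilTheta D hθ).toIdeal, ((s𝔫 a : (nilTheta D hθ).toIdeal) : AinfRamWTop D) = s a)
    (hsφ : ∀ a : (nilTheta D hθ).toIdeal, s𝔫 (φ a) = φ (s𝔫 a))
    {u su : ℕ → (nilTheta D hθ).toIdeal} (hsu_def : ∀ n, su n = s𝔫 (u n))
    (hu : ∀ n, ((φ (u (n + 1)) : (nilTheta D hθ).toIdeal) : AinfRamWTop D) - u n ∈ (WithIdeal.i : Ideal (AinfRamWTop D)))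
    (hsu : ∀ n, ((φ (su (n + 1)) : (nilTheta D hθ).toIdeal) : AinfRamWTop D) - su n ∈ (WithIdeal.i : Ideal (AinfRamWTop D))) :
    s (flim hφ u hu) = flim hφ su hsu := by
  -- `s` commutes with the iterates of `φ`
  have hiter : ∀ (n : ℕ) (a : (nilTheta D hθ).toIdeal), s𝔫 (φ^[n] a) = φ^[n] (s𝔫 a) := by
    intro n
    induction n with
    | zero => intro a; rfl
    | succ n ih => intro a; rw [Function.iterate_succ_apply, Function.iterate_succ_apply, ← hsφ, ih]
  have h1 : Tendsto (fun n => s (approx φ u n)) atTop (𝓝 (s (flim hφ u hu))) :=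
    (hs.tendsto (flim hφ u hu)).comp (tendsto_approx_flim hφ hu)
  have h2 : (fun n => s (approx φ u n)) = approx φ su := by
    funext n
    rw [approx_def, approx_def, ← hs𝔫, hiter, hsu_def]
  rw [h2] at h1
  exact tendsto_nhds_unique h1 (tendsto_approx_flim hφ hsu)

/-! ## §3 Fontaine's limit is a point of `𝔫_𝒪`; additivity -/

/-- **Fontaine's limit lies in `𝔫`** (`[u] = φ⁰(u₀) + ([u] − φ⁰(u₀))`, the latter in `(p, ω) ⊆ 𝔫`).
[cite: FontaineAsterisque223III, Exp. II §1.2.2] -/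
theorem flim_mem_nilTheta (hφ : IsContracting hθ φ) {u : ℕ → (nilTheta D hθ).toIdeal}
    (hu : ∀ n, ((φ (u (n + 1)) : (nilTheta D hθ).toIdeal) : AinfRamWTop D) - u n ∈ (WithIdeal.i : Ideal (AinfRamWTop D))) :
    flim hφ u hu ∈ (nilTheta D hθ).toIdeal := by
  have h := flim_sub_approx_mem hφ hu 0
  rw [zero_add, pow_one] at h
  have : flim hφ u hu = (flim hφ u hu - approx φ u 0) + approx φ u 0 := by ring
  rw [this]
  exact Submodule.add_mem _ (ideal_le_nilTheta h) (by rw [approx_def]; exact (u 0).2)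

/-- Fontaine's limit as a point of `𝔫`. [cite: FontaineAsterisque223III, Exp. II §1.2.2] -/
def flimPt (hφ : IsContracting hθ φ) (u : ℕ → (nilTheta D hθ).toIdeal)
    (hu : ∀ n, ((φ (u (n + 1)) : (nilTheta D hθ).toIdeal) : AinfRamWTop D) - u n ∈ (WithIdeal.i : Ideal (AinfRamWTop D))) :
    (nilTheta D hθ).toIdeal :=
  ⟨flim hφ u hu, flim_mem_nilTheta hφ hu⟩

/-- Unfolding `flimPt`. [cite: FontaineAsterisque223III, Exp. II §1.2.2] -/
@[simp] theorem coe_flimPt (hφ : IsContracting hθ φ) (u : ℕ → (nilTheta D hθ).toIdeal)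
    (hu : ∀ n, ((φ (u (n + 1)) : (nilTheta D hθ).toIdeal) : AinfRamWTop D) - u n ∈ (WithIdeal.i : Ideal (AinfRamWTop D))) :
    (flimPt hφ u hu : AinfRamWTop D) = flim hφ u hu := rfl

variable {op : (nilTheta D hθ).toIdeal → (nilTheta D hθ).toIdeal → (nilTheta D hθ).toIdeal}

/-- The sum of two `φ`-compatible sequences is `φ`-compatible (congruence-continuity of `⊕` at level `(p, ω)`).
[cite: FontaineAsterisque223III, Exp. II §1.2.1] -/
theorem op_compatible
    (hcong : ∀ (k : ℕ) (a a' b b' : (nilTheta D hθ).toIdeal),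
      (a : AinfRamWTop D) - a' ∈ (WithIdeal.i ^ (k + 1) : Ideal (AinfRamWTop D)) →
      (b : AinfRamWTop D) - b' ∈ (WithIdeal.i ^ (k + 1) : Ideal (AinfRamWTop D)) →
      (op a b : AinfRamWTop D) - op a' b' ∈ (WithIdeal.i ^ (k + 1) : Ideal (AinfRamWTop D)))
    (hop : ∀ a b, φ (op a b) = op (φ a) (φ b)) {u u' : ℕ → (nilTheta D hθ).toIdeal}
    (hu : ∀ n, ((φ (u (n + 1)) : (nilTheta D hθ).toIdeal) : AinfRamWTop D) - u n ∈ (WithIdeal.i : Ideal (AinfRamWTop D)))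
    (hu' : ∀ n, ((φ (u' (n + 1)) : (nilTheta D hθ).toIdeal) : AinfRamWTop D) - u' n ∈ (WithIdeal.i : Ideal (AinfRamWTop D)))
    (n : ℕ) :
    ((φ (op (u (n + 1)) (u' (n + 1))) : (nilTheta D hθ).toIdeal) : AinfRamWTop D) - op (u n) (u' n) ∈
      (WithIdeal.i : Ideal (AinfRamWTop D)) := by
  rw [hop]
  have h := hcong 0 (φ (u (n + 1))) (u n) (φ (u' (n + 1))) (u' n) (by rw [zero_add, pow_one]; exact hu n)
    (by rw [zero_add, pow_one]; exact hu' n)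
  rwa [zero_add, pow_one] at h

/-- **Additivity of Fontaine's limit: `[u ⊕ u'] = [u] ⊕ [u']`.** [cite: FontaineAsterisque223III, Exp. II §1.2.2]
[cite: SilvermanAEC2009, IV.2.3] -/
theorem flim_op (hφ : IsContracting hθ φ)
    (hcong : ∀ (k : ℕ) (a a' b b' : (nilTheta D hθ).toIdeal),
      (a : AinfRamWTop D) - a' ∈ (WithIdeal.i ^ (k + 1) : Ideal (AinfRamWTop D)) →
      (b : AinfRamWTop D) - b' ∈ (WithIdeal.i ^ (k + 1) : Ideal (AinfRamWTop D)) →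
      (op a b : AinfRamWTop D) - op a' b' ∈ (WithIdeal.i ^ (k + 1) : Ideal (AinfRamWTop D)))
    (hop : ∀ a b, φ (op a b) = op (φ a) (φ b)) {u u' w : ℕ → (nilTheta D hθ).toIdeal}
    (hw_def : ∀ n, w n = op (u n) (u' n))
    (hu : ∀ n, ((φ (u (n + 1)) : (nilTheta D hθ).toIdeal) : AinfRamWTop D) - u n ∈ (WithIdeal.i : Ideal (AinfRamWTop D)))
    (hu' : ∀ n, ((φ (u' (n + 1)) : (nilTheta D hθ).toIdeal) : AinfRamWTop D) - u' n ∈ (WithIdeal.i : Ideal (AinfRamWTop D)))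
    (hw : ∀ n, ((φ (w (n + 1)) : (nilTheta D hθ).toIdeal) : AinfRamWTop D) - w n ∈ (WithIdeal.i : Ideal (AinfRamWTop D))) :
    flim hφ w hw = (op (flimPt hφ u hu) (flimPt hφ u' hu') : AinfRamWTop D) := by
  -- `φⁿ(a ⊕ b) = φⁿ a ⊕ φⁿ b`
  have iterate_op : ∀ (n : ℕ) (a b : (nilTheta D hθ).toIdeal), φ^[n] (op a b) = op (φ^[n] a) (φ^[n] b) := by
    intro n
    induction n with
    | zero => intro a b; rfl
    | succ n ih => intro a b; rw [Function.iterate_succ_apply, Function.iterate_succ_apply, Function.iterate_succ_apply, hop, ih]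
  symm
  refine eq_flim_of_forall_sub_mem hφ hw fun n => ?_
  rw [approx_def, hw_def, iterate_op]
  exact hcong n _ _ _ _ (by rw [coe_flimPt, ← approx_def]; exact flim_sub_approx_mem hφ hu n)
    (by rw [coe_flimPt, ← approx_def]; exact flim_sub_approx_mem hφ hu' n)

/-! ## §4 `θ_𝒪` of a Fontaine limit with constant `θ_𝒪`-values -/

/-- `θ_𝒪` of a Fontaine limit all of whose approximants have the same `θ_𝒪`-value `c` is `c` (continuity of `θ_𝒪`).
[cite: FontaineAsterisque223III, Exp. II §1.2.2] -/
theorem theta_flim_eq_of_forall {φ : (nilTheta D hθ).toIdeal → (nilTheta D hθ).toIdeal} (hφ : IsContracting hθ φ)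
    {u : ℕ → (nilTheta D hθ).toIdeal}
    (hu : ∀ n, ((φ (u (n + 1)) : (nilTheta D hθ).toIdeal) : AinfRamWTop D) - u n ∈ (WithIdeal.i : Ideal (AinfRamWTop D)))
    {c : CBall F} (hc : ∀ n, theta D (approx φ u n) = c) : theta D (flim hφ u hu) = c := by
  have h1 : Tendsto (fun n => theta D (approx φ u n)) atTop (𝓝 (theta D (flim hφ u hu))) :=
    ((continuous_theta (D := D)).tendsto (flim hφ u hu)).comp (tendsto_approx_flim hφ hu)
  have h2 : (fun n => theta D (approx φ u n)) = fun _ => c := funext hc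
  rw [h2] at h1
  exact (tendsto_nhds_unique tendsto_const_nhds h1).symm

end AinfRamWTop

end Literature.NumberTheory.PAdicHodge

end
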